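import Summits.Ventures.PackingBounds.Energy.FivePointRieszFourNDefs
import Summits.Ventures.PackingBounds.Energy.FivePointRieszFourNBridge
import HarnessLib

/-!
# `FivePointRieszFourN`: the slack of the three-point inequality is `Σ_i m_i · (Gram form)` and nonnegative on the domain

Framing: lottery ticket; floor = certified bounds/negative ranges. Venture `PackingBounds`, cell
`pub-packcert`, energy family E3PT (pub-packcert-energy gen 11).
-/

noncomputable section

namespace Summit.Ventures.PackingBounds.Energy.FivePointRieszFourN

set_option maxRecDepth 20000 in
set_option maxHeartbeats 400000000 in
/-- The slack of the three-point inequality equals `Σ_i m_i(u,v,t) · w_i(u,v,t)ᵀ Y_i w_i(u,v,t)` (`ring`). -/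
theorem rexp_eqR4 (u v t : ℝ) :
    (pminKR4 u + pminKR4 v + pminKR4 t) / 3 - (c0KR4 + 3 * FexpKR4 u v t + FexpKR4 u u 1 + FexpKR4 v v 1 + FexpKR4 t t 1
      + (a1KR4 * u + a1KR4 * v + a1KR4 * t) / 3)
      = quad_1R4 (wv_1R4 u v t) := by
  unfold pminKR4 FexpKR4 c0KR4 a1KR4 quad_1R4 quad_1_0R4 quad_1_1R4 quad_1_2R4 quad_1_3R4 quad_1_4R4 quad_1_5R4 quad_1_6R4 quad_1_7R4 quad_1_8R4 quad_1_9R4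
  simp only [wv_1R4]
  ring

/-- The slack polynomial is nonnegative on the domain `D` (each multiplier `≥ 0` on `D`, each Gram block PSD). -/
theorem slack_nonnegR4 (u v t : ℝ)  :
    0 ≤ (pminKR4 u + pminKR4 v + pminKR4 t) / 3 - (c0KR4 + 3 * FexpKR4 u v t + FexpKR4 u u 1 + FexpKR4 v v 1 + FexpKR4 t t 1
      + (a1KR4 * u + a1KR4 * v + a1KR4 * t) / 3) := by
  rw [rexp_eqR4]
  exact (quad_1_nonnegR4 (wv_1R4 u v t))

end Summit.Ventures.PackingBounds.Energy.FivePointRieszFourN
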